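import Summits.Parity.BatemanHorn.Theorems.SoloInformedLocatedMangoldt
import Literature.NumberTheory.Sieve.MoebiusShiftedPrimesMinorArcForm

/-!
# SoloInformedPrimePowerLayer — the proper prime powers of the located von Mangoldt layer, sandwiched by the large square divisors of the values

Solo unit `solo-Parity-informed` (ideation tier, informed mode), session 47; `PLAN.md` §49, CLAIMS C123;
`paper/referee-notes.md` R80 (the elementary sandwich stated there in prose is made kernel here and in the companion file
`SoloInformedPrimeLayerSquarefree`, which draws the asymptotic conclusions).

CONTEXT.  `SoloInformedLocatedMangoldt` (Theorem A there, `locatedVonMangoldt_isLittleO`) proves, for every irreducible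
`g ∈ ℤ[X]` of degree `d ≥ 1` without roots in `ℕ_{≥ 1}` (leading coefficient `a`, Mertens constant `γ_g`) and every
`0 < ε < 1`, the two-term expansion of the located VON MANGOLDT layer of the values,

  `∑_{n ≤ x} ∑_{e ∣ g(n), e > x^{1-ε}} Λ(e) = (d - 1 + ε) x log x - (d - log |a| - γ_g) x + o(x)`,

in which `e` runs over ALL prime powers.  The PRIME layer `P_g(x) := ∑_{n ≤ x} ∑_{p ∣ g(n), p prime, p > x^{1-ε}} log p`
(`primeLayer`) differs from it by the proper-prime-power layer
`PP_g(x) := ∑_{n ≤ x} ∑_{e ∣ g(n), e > x^{1-ε}, e not prime} Λ(e) = ∑_{n ≤ x} ∑_{p^j ∣ g(n), j ≥ 2, p^j > x^{1-ε}} log p`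
(`primePowLayer`; `primeLayer_add_primePowLayer`).  This file sandwiches `PP_g` by two counts of values of `g`:

  `S_g(x) := #{1 ≤ n ≤ x : p² ∣ g(n) for some prime p > x^{1-ε}}`                        (`sqDivCount`),
  `B_g(x) := #{1 ≤ n ≤ x : p^{⌊log_p D⌋ + 1} ∣ g(n) for some prime p ≤ D}`,  `D = ⌊x^{1-ε}⌋`  (`smallPrimePowCount`).

* `mul_sqDivCount_le_primePowLayer` (LOWER SANDWICH; every `g` without roots in `ℕ_{≥ 1}`, every real `ε`, every `x`):
    `(1 - ε) · log x · S_g(x) ≤ PP_g(x)`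
  (each `n` counted by `S_g` carries the term `Λ(p²) = log p > (1 - ε) log x`).
* `primePowLayer_le_mul_add` (UPPER SANDWICH; every `g` of degree `d ≥ 1`, every real `ε`, every `x`):
    `PP_g(x) ≤ (d log x + C_g) · (S_g(x) + B_g(x))`
  (`large_sq_or_small_pow_of_vonMangoldt_ne_zero`: a non-zero term is `Λ(p^j)` with `j ≥ 2`, `p^j > D`; either `p > D`,
  and `n` is counted by `S_g`, or `p ≤ D < p^j`, and then the first power of `p` past `D` divides `g(n)`: `n` is counted
  by `B_g`; in both cases the inner sum is `≤ ∑_{e ∣ g(n)} Λ(e) = log |g(n)| ≤ d log x + C_g`, `exists_log_natAbs_eval_le`).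
* `smallPrimePowCount_le` (every `g` irreducible of degree `d ≥ 1`, every real `ε`, every `x`):
    `B_g(x) ≤ d M_g · (x (1 + log D)/√(D+1) + D)`
  (the first power `q` of `p ≤ D` past `D` has `q > D` and `q ≥ p²`, so `q ≥ p √(D+1)`; `#{n ≤ x : q ∣ g(n)} ≤ x ρ_g(q)/q
  + ρ_g(q)` by `abs_card_filter_dvd_eval_sub_le`, `ρ_g(p^j) ≤ d M_g` by the tree's `exists_polyRootCountMod_prime_pow_le`,
  and `∑_{p ≤ D} 1/p ≤ 1 + log D`).  With `D = ⌊x^{1-ε}⌋` this is `≪_g x^{(1+ε)/2} log x + x^{1-ε}`, negligible against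
  `x / log x` for `0 < ε < 1` — drawn out in `SoloInformedPrimeLayerSquarefree`, where the conclusion
  `P_g(x) = (d - 1 + ε) x log x - (d - log |a| - γ_g) x + o(x) ⟺ S_g(x) = o(x / log x)` is proved.

`S_g` is the hard range of the square-free sieve for the values of `g` (the primes `p ≤ x^{1-ε}` are its easy range,
`#{n ≤ x : p² ∣ g(n)} = x ρ_g(p²)/p² + O(1)`); see the companion file for the literature.  Nothing here is used by, or
bears on, the localisation theorems of the unit (`SoloInformedBatemanHornLocalisation`), which are stated with `Λ` and
`μ · log` and keep the prime powers; no bearing on the truth of the conjecture.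
-/

namespace Summit.Parity.BatemanHorn.Theorems

open Finset Filter ArithmeticFunction Asymptotics Polynomial
open scoped Topology Classical
open Literature.NumberTheory.Sieve (polyRootCountMod)

namespace LocatedMangoldt

/-- The located PRIME layer of the values of `g` above the cut `x^{1-ε}`:
`P_g(x) = ∑_{1 ≤ n ≤ x} ∑_{p ∣ g(n), p prime, p > x^{1-ε}} log p`. -/
noncomputable def primeLayer (g : ℤ[X]) (ε : ℝ) (x : ℕ) : ℝ :=
  ∑ n ∈ Icc 1 x, ∑ e ∈ ((g.eval (n : ℤ)).natAbs.divisors).filter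
    (fun e => ⌊(x : ℝ) ^ (1 - ε)⌋₊ < e ∧ e.Prime), Λ e

/-- The located PROPER-PRIME-POWER layer of the values of `g` above the cut `x^{1-ε}`:
`PP_g(x) = ∑_{1 ≤ n ≤ x} ∑_{e ∣ g(n), e > x^{1-ε}, e not prime} Λ(e) = ∑_{n ≤ x} ∑_{p^j ∣ g(n), j ≥ 2, p^j > x^{1-ε}} log p`. -/
noncomputable def primePowLayer (g : ℤ[X]) (ε : ℝ) (x : ℕ) : ℝ :=
  ∑ n ∈ Icc 1 x, ∑ e ∈ ((g.eval (n : ℤ)).natAbs.divisors).filter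
    (fun e => ⌊(x : ℝ) ^ (1 - ε)⌋₊ < e ∧ ¬e.Prime), Λ e

/-- The LARGE-SQUARE-DIVISOR count of the values of `g`:
`S_g(x) = #{1 ≤ n ≤ x : p² ∣ g(n) for some prime p > x^{1-ε}}` — the hard range of the square-free sieve for `g`. -/
noncomputable def sqDivCount (g : ℤ[X]) (ε : ℝ) (x : ℕ) : ℕ :=
  #((Icc 1 x).filter fun n : ℕ =>
    ∃ p : ℕ, p.Prime ∧ ⌊(x : ℝ) ^ (1 - ε)⌋₊ < p ∧ p ^ 2 ∣ (g.eval (n : ℤ)).natAbs)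

/-- The SMALL-PRIME count: values of `g` divisible by the first power `p^{j}` past the cut (`p^{j-1} ≤ x^{1-ε} < p^j`,
so `j ≥ 2`) of some prime `p ≤ x^{1-ε}`:
`B_g(x) = #{1 ≤ n ≤ x : p^{⌊log_p x^{1-ε}⌋ + 1} ∣ g(n) for some prime p ≤ x^{1-ε}}`. -/
noncomputable def smallPrimePowCount (g : ℤ[X]) (ε : ℝ) (x : ℕ) : ℕ :=
  #((Icc 1 x).filter fun n : ℕ =>
    ∃ p : ℕ, p.Prime ∧ p ≤ ⌊(x : ℝ) ^ (1 - ε)⌋₊ ∧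
      p ^ (Nat.log p ⌊(x : ℝ) ^ (1 - ε)⌋₊ + 1) ∣ (g.eval (n : ℤ)).natAbs)

/-! ### The split of the located von Mangoldt layer -/

/-- `P_g(x) + PP_g(x) = ∑_{n ≤ x} ∑_{e ∣ g(n), e > x^{1-ε}} Λ(e)` (the located von Mangoldt layer of
`locatedVonMangoldt_isLittleO`). -/
theorem primeLayer_add_primePowLayer (g : ℤ[X]) (ε : ℝ) (x : ℕ) :
    primeLayer g ε x + primePowLayer g ε x =
      ∑ n ∈ Icc 1 x, ∑ e ∈ ((g.eval (n : ℤ)).natAbs.divisors).filter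
        (fun e => ⌊(x : ℝ) ^ (1 - ε)⌋₊ < e), Λ e := by
  unfold primeLayer primePowLayer
  rw [← sum_add_distrib]
  refine sum_congr rfl fun n _ => ?_
  have h := sum_filter_add_sum_filter_not
    (((g.eval (n : ℤ)).natAbs.divisors).filter fun e => ⌊(x : ℝ) ^ (1 - ε)⌋₊ < e)
    (fun e : ℕ => e.Prime) (fun e : ℕ => Λ e)
  simpa only [filter_filter] using h

/-! ### The lower sandwich: each `n` counted by `S_g` carries a term `Λ(p²) = log p > (1-ε) log x` -/

/-- **Lower sandwich.** `(1 - ε) · log x · S_g(x) ≤ PP_g(x)` for every `g` without roots in `ℕ_{≥ 1}`, every real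
`ε` and every `x`. -/
theorem mul_sqDivCount_le_primePowLayer (g : ℤ[X]) (hg0 : ∀ n : ℕ, 1 ≤ n → g.eval (n : ℤ) ≠ 0)
    (ε : ℝ) (x : ℕ) :
    (1 - ε) * Real.log x * (sqDivCount g ε x : ℝ) ≤ primePowLayer g ε x := by
  unfold sqDivCount primePowLayer
  set D : ℕ := ⌊(x : ℝ) ^ (1 - ε)⌋₊ with hD
  set S := (Icc 1 x).filter fun n : ℕ =>
    ∃ p : ℕ, p.Prime ∧ D < p ∧ p ^ 2 ∣ (g.eval (n : ℤ)).natAbs with hS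
  have key : ∀ n ∈ S, (1 - ε) * Real.log x ≤
      ∑ e ∈ ((g.eval (n : ℤ)).natAbs.divisors).filter (fun e => D < e ∧ ¬e.Prime), Λ e := by
    intro n hn
    obtain ⟨hnI, p, hp, hDp, hp2⟩ := mem_filter.mp hn
    have hN0 : (g.eval (n : ℤ)).natAbs ≠ 0 := Int.natAbs_ne_zero.mpr (hg0 n (mem_Icc.mp hnI).1)
    have hmem : p ^ 2 ∈ ((g.eval (n : ℤ)).natAbs.divisors).filter (fun e => D < e ∧ ¬e.Prime) := by
      refine mem_filter.mpr ⟨Nat.mem_divisors.mpr ⟨hp2, hN0⟩, ?_, Nat.Prime.not_prime_pow le_rfl⟩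
      exact lt_of_lt_of_le hDp (Nat.le_self_pow two_ne_zero p)
    have hΛ : Λ (p ^ 2) = Real.log p := by
      rw [vonMangoldt_apply_pow two_ne_zero, vonMangoldt_apply_prime hp]
    have hlog : (1 - ε) * Real.log x ≤ Real.log p := by
      rcases Nat.eq_zero_or_pos x with hx | hx
      · rw [hx, Nat.cast_zero, Real.log_zero, mul_zero]
        exact Real.log_natCast_nonneg p
      · have hx0 : (0 : ℝ) < x := by exact_mod_cast hx
        rw [← Real.log_rpow hx0]
        refine Real.log_le_log (Real.rpow_pos_of_pos hx0 _) ?_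
        have h1 : (x : ℝ) ^ (1 - ε) < (D : ℝ) + 1 := Nat.lt_floor_add_one _
        have h2 : (D : ℝ) + 1 ≤ p := by exact_mod_cast hDp
        linarith
    calc (1 - ε) * Real.log x ≤ Real.log p := hlog
      _ = Λ (p ^ 2) := hΛ.symm
      _ ≤ ∑ e ∈ ((g.eval (n : ℤ)).natAbs.divisors).filter (fun e => D < e ∧ ¬e.Prime), Λ e :=
          single_le_sum (f := fun e : ℕ => Λ e) (fun e _ => vonMangoldt_nonneg) hmem
  calc (1 - ε) * Real.log x * (#S : ℝ) = ∑ n ∈ S, (1 - ε) * Real.log x := by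
        rw [sum_const, nsmul_eq_mul, mul_comm]
    _ ≤ ∑ n ∈ S, ∑ e ∈ ((g.eval (n : ℤ)).natAbs.divisors).filter (fun e => D < e ∧ ¬e.Prime), Λ e :=
        sum_le_sum key
    _ ≤ ∑ n ∈ Icc 1 x, ∑ e ∈ ((g.eval (n : ℤ)).natAbs.divisors).filter (fun e => D < e ∧ ¬e.Prime),
          Λ e :=
        sum_le_sum_of_subset_of_nonneg (filter_subset _ _)
          (fun n _ _ => sum_nonneg fun e _ => vonMangoldt_nonneg)


/-! ### The upper sandwich: a non-zero term is a proper prime power `p^j > x^{1-ε}`, and then either `p > x^{1-ε}`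
(so `p² ∣ g(n)`: `n` is counted by `S_g`) or `p ≤ x^{1-ε} < p^j` (so the first power of `p` past the cut divides
`g(n)`: `n` is counted by `B_g`); in both cases the whole inner sum is at most `∑_{e ∣ g(n)} Λ(e) = log |g(n)|`. -/

/-- `log |g(n)| ≤ deg g · log x + C_g` for `1 ≤ n ≤ x`. -/
theorem exists_log_natAbs_eval_le {g : ℤ[X]} (hdeg : 0 < g.natDegree) :
    ∃ C : ℝ, 0 ≤ C ∧ ∀ x n : ℕ, 1 ≤ n → n ≤ x →
      Real.log ((g.eval (n : ℤ)).natAbs : ℝ) ≤ g.natDegree * Real.log x + C := by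
  obtain ⟨K, hK0, hK⟩ := exists_abs_log_eval_sub_le_div hdeg
  refine ⟨|Real.log (|(g.leadingCoeff : ℝ)|)| + K, by positivity, fun x n hn hnx => ?_⟩
  have h := hK n hn
  have hn0 : (0 : ℝ) < n := by exact_mod_cast hn
  have hKn : K / n ≤ K := div_le_self hK0 (by exact_mod_cast hn)
  have hlog : Real.log n ≤ Real.log x := Real.log_le_log hn0 (by exact_mod_cast hnx)
  have hd : (0 : ℝ) ≤ g.natDegree := Nat.cast_nonneg _
  have hdl := mul_le_mul_of_nonneg_left hlog hd
  have ha := le_abs_self (Real.log (|(g.leadingCoeff : ℝ)|))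
  rw [abs_le] at h
  linarith [h.2]

/-- A sub-sum of `∑_{e ∣ N} Λ(e) = log N` is at most `log N`. -/
theorem sum_filter_divisors_vonMangoldt_le (N : ℕ) (P : ℕ → Prop) [DecidablePred P] :
    ∑ e ∈ N.divisors.filter P, Λ e ≤ Real.log N := by
  rw [← vonMangoldt_sum]
  exact sum_le_sum_of_subset_of_nonneg (filter_subset _ _) fun e _ _ => vonMangoldt_nonneg

/-- **The dichotomy.** If `e ∣ N`, `e > D`, `e` is not prime and `Λ(e) ≠ 0`, then `e = p^j` with `j ≥ 2`, and either
`p > D` and `p² ∣ N`, or `p ≤ D` and `p^{⌊log_p D⌋ + 1} ∣ N`. -/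
theorem large_sq_or_small_pow_of_vonMangoldt_ne_zero {N D e : ℕ} (heN : e ∣ N) (hDe : D < e)
    (hne : ¬e.Prime) (hΛ : Λ e ≠ 0) :
    (∃ p : ℕ, p.Prime ∧ D < p ∧ p ^ 2 ∣ N) ∨
      (∃ p : ℕ, p.Prime ∧ p ≤ D ∧ p ^ (Nat.log p D + 1) ∣ N) := by
  obtain ⟨p, k, hp, hk, rfl⟩ := (isPrimePow_nat_iff e).mp (vonMangoldt_ne_zero_iff.mp hΛ)
  have hk2 : 2 ≤ k := by
    by_contra h
    have hk1 : k = 1 := by omega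
    subst hk1
    exact hne (by simpa using hp)
  rcases lt_or_ge D p with hDp | hpD
  · exact Or.inl ⟨p, hp, hDp, (pow_dvd_pow p hk2).trans heN⟩
  · right
    refine ⟨p, hp, hpD, (pow_dvd_pow p ?_).trans heN⟩
    have hD0 : D ≠ 0 := by have := hp.two_le; omega
    have h1 : p ^ Nat.log p D ≤ D := Nat.pow_log_le_self p hD0
    have h2 : p ^ Nat.log p D < p ^ k := lt_of_le_of_lt h1 hDe
    exact (Nat.pow_lt_pow_iff_right hp.one_lt).mp h2

/-- **Upper sandwich.** `PP_g(x) ≤ (deg g · log x + C_g) · (S_g(x) + B_g(x))` for every `g` of degree `≥ 1`,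
every real `ε` and every `x`. -/
theorem primePowLayer_le_mul_add {g : ℤ[X]} (hdeg : 0 < g.natDegree) :
    ∃ C : ℝ, 0 ≤ C ∧ ∀ (ε : ℝ) (x : ℕ),
      primePowLayer g ε x ≤
        (g.natDegree * Real.log x + C) * (sqDivCount g ε x + smallPrimePowCount g ε x : ℝ) := by
  obtain ⟨C, hC0, hC⟩ := exists_log_natAbs_eval_le hdeg
  refine ⟨C, hC0, fun ε x => ?_⟩
  unfold primePowLayer sqDivCount smallPrimePowCount
  set D : ℕ := ⌊(x : ℝ) ^ (1 - ε)⌋₊ with hD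
  set PS : ℕ → Prop := fun n : ℕ => ∃ p : ℕ, p.Prime ∧ D < p ∧ p ^ 2 ∣ (g.eval (n : ℤ)).natAbs with hPS
  set PB : ℕ → Prop := fun n : ℕ =>
    ∃ p : ℕ, p.Prime ∧ p ≤ D ∧ p ^ (Nat.log p D + 1) ∣ (g.eval (n : ℤ)).natAbs with hPB
  set inner : ℕ → ℝ := fun n =>
    ∑ e ∈ ((g.eval (n : ℤ)).natAbs.divisors).filter (fun e => D < e ∧ ¬e.Prime), Λ e with hinner
  have hb0 : 0 ≤ (g.natDegree : ℝ) * Real.log x + C := by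
    have := Real.log_natCast_nonneg x
    positivity
  -- (1) the inner sum vanishes unless `PS n ∨ PB n`
  have hvanish : ∀ n ∈ Icc 1 x, inner n ≠ 0 → PS n ∨ PB n := by
    intro n _ hn
    obtain ⟨e, he, hΛ⟩ := exists_ne_zero_of_sum_ne_zero hn
    obtain ⟨he1, hDe, hne⟩ := mem_filter.mp he
    exact large_sq_or_small_pow_of_vonMangoldt_ne_zero (Nat.dvd_of_mem_divisors he1) hDe hne hΛ
  -- (2) each inner sum is at most `log |g(n)| ≤ d log x + C`
  have hle : ∀ n ∈ (Icc 1 x).filter (fun n => PS n ∨ PB n), inner n ≤ g.natDegree * Real.log x + C := by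
    intro n hn
    have hnI := mem_Icc.mp (mem_filter.mp hn).1
    exact (sum_filter_divisors_vonMangoldt_le _ _).trans (hC x n hnI.1 hnI.2)
  calc ∑ n ∈ Icc 1 x, inner n = ∑ n ∈ (Icc 1 x).filter (fun n => PS n ∨ PB n), inner n :=
        (sum_filter_of_ne hvanish).symm
    _ ≤ (#((Icc 1 x).filter fun n => PS n ∨ PB n) : ℝ) * (g.natDegree * Real.log x + C) := by
        have h := sum_le_card_nsmul _ _ _ hle
        rwa [nsmul_eq_mul] at h
    _ ≤ ((#((Icc 1 x).filter PS) : ℝ) + #((Icc 1 x).filter PB)) * (g.natDegree * Real.log x + C) := by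
        refine mul_le_mul_of_nonneg_right ?_ hb0
        rw [filter_or]
        exact_mod_cast card_union_le _ _
    _ = _ := by ring

/-! ### The small-prime count `B_g` is negligible: `B_g(x) ≪_g x (1 + log D)/√(D+1) + D`, `D = ⌊x^{1-ε}⌋` -/

/-- **The small-prime count.** For `g` irreducible of degree `d ≥ 1`, with `ρ_g(p^a) ≤ d M_g`
(`exists_polyRootCountMod_prime_pow_le`): since the first power `q = p^j` of `p ≤ D` past `D` has `q > D` and
`q ≥ p²`, hence `q ≥ p √(D+1)`, and `#{n ≤ x : q ∣ g(n)} ≤ x ρ_g(q)/q + ρ_g(q)`,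
`B_g(x) ≤ d M_g · (x (1 + log D)/√(D+1) + D)` with `D = ⌊x^{1-ε}⌋`. -/
theorem smallPrimePowCount_le {g : ℤ[X]} (hirr : Irreducible g) (hdeg : 0 < g.natDegree) :
    ∃ C : ℝ, 0 ≤ C ∧ ∀ (ε : ℝ) (x : ℕ),
      (smallPrimePowCount g ε x : ℝ) ≤
        C * ((x : ℝ) * (1 + Real.log (⌊(x : ℝ) ^ (1 - ε)⌋₊ : ℕ)) / Real.sqrt ((⌊(x : ℝ) ^ (1 - ε)⌋₊ : ℕ) + 1)
          + (⌊(x : ℝ) ^ (1 - ε)⌋₊ : ℕ)) := by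
  obtain ⟨M, hM1, hM⟩ := Literature.NumberTheory.Sieve.exists_polyRootCountMod_prime_pow_le hirr hdeg
  refine ⟨(g.natDegree * M : ℕ), by positivity, fun ε x => ?_⟩
  unfold smallPrimePowCount
  set D : ℕ := ⌊(x : ℝ) ^ (1 - ε)⌋₊ with hD
  set Pr := (Icc 1 D).filter Nat.Prime with hPr
  set q : ℕ → ℕ := fun p => p ^ (Nat.log p D + 1) with hq
  have hsq0 : 0 < Real.sqrt ((D : ℝ) + 1) := Real.sqrt_pos.mpr (by positivity)
  -- cover: `B`-set ⊆ ⋃_{p ∈ Pr} {n ∈ [1, x] : q(p) ∣ g(n)}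
  have hcover : ((Icc 1 x).filter fun n : ℕ =>
        ∃ p : ℕ, p.Prime ∧ p ≤ D ∧ p ^ (Nat.log p D + 1) ∣ (g.eval (n : ℤ)).natAbs)
      ⊆ Pr.biUnion fun p => (Icc 1 x).filter fun n : ℕ => (q p : ℤ) ∣ g.eval (n : ℤ) := by
    intro n hn
    obtain ⟨hnI, p, hp, hpD, hdvd⟩ := mem_filter.mp hn
    refine mem_biUnion.mpr ⟨p, mem_filter.mpr ⟨mem_Icc.mpr ⟨hp.one_lt.le, hpD⟩, hp⟩,
      mem_filter.mpr ⟨hnI, ?_⟩⟩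
    exact Int.natCast_dvd.mpr hdvd
  -- each piece: `#{n ≤ x : q ∣ g(n)} ≤ x ρ(q)/q + ρ(q) ≤ d M (x/q + 1)`
  have hpiece : ∀ p ∈ Pr, (#((Icc 1 x).filter fun n : ℕ => (q p : ℤ) ∣ g.eval (n : ℤ)) : ℝ)
      ≤ (g.natDegree * M : ℕ) * ((x : ℝ) / q p + 1) := by
    intro p hp
    have hp' : p.Prime := (mem_filter.mp hp).2
    have hq0 : 0 < q p := pow_pos hp'.pos _
    have h1 := abs_card_filter_dvd_eval_sub_le g hq0 x
    have hρ : (polyRootCountMod ![g] (q p) : ℝ) ≤ (g.natDegree * M : ℕ) := by exact_mod_cast hM p hp' _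
    rw [abs_le] at h1
    have hq0' : (0 : ℝ) < q p := by exact_mod_cast hq0
    have hx0 : (0 : ℝ) ≤ x := Nat.cast_nonneg x
    calc (#((Icc 1 x).filter fun n : ℕ => (q p : ℤ) ∣ g.eval (n : ℤ)) : ℝ)
        ≤ (x : ℝ) * (polyRootCountMod ![g] (q p) : ℝ) / q p + polyRootCountMod ![g] (q p) := by
          linarith [h1.2]
      _ ≤ (x : ℝ) * (g.natDegree * M : ℕ) / q p + (g.natDegree * M : ℕ) := by gcongr
      _ = (g.natDegree * M : ℕ) * ((x : ℝ) / q p + 1) := by ring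
  -- `q(p) ≥ p √(D+1)` for `p ∈ Pr`
  have hqlarge : ∀ p ∈ Pr, (p : ℝ) * Real.sqrt ((D : ℝ) + 1) ≤ q p := by
    intro p hp
    obtain ⟨hpI, hp'⟩ := mem_filter.mp hp
    have hpD : p ≤ D := (mem_Icc.mp hpI).2
    have h1 : D < q p := Nat.lt_pow_succ_log_self hp'.one_lt D
    have h2 : p ^ 2 ≤ q p := by
      apply Nat.pow_le_pow_right hp'.pos
      have : 0 < Nat.log p D := Nat.log_pos hp'.one_lt hpD
      omega
    have h3 : ((p : ℝ) * Real.sqrt ((D : ℝ) + 1)) ^ 2 ≤ ((q p : ℕ) : ℝ) ^ 2 := by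
      rw [mul_pow, Real.sq_sqrt (by positivity)]
      have h1' : (D : ℝ) + 1 ≤ q p := by exact_mod_cast h1
      have h2' : (p : ℝ) ^ 2 ≤ q p := by exact_mod_cast h2
      calc (p : ℝ) ^ 2 * ((D : ℝ) + 1) ≤ (q p : ℝ) * (q p : ℝ) :=
            mul_le_mul h2' h1' (by positivity) (by positivity)
        _ = (q p : ℝ) ^ 2 := by ring
    exact (pow_le_pow_iff_left₀ (by positivity) (by positivity) two_ne_zero).mp h3
  have hPrD : (#Pr : ℝ) ≤ D := by
    calc (#Pr : ℝ) ≤ #(Icc 1 D) := by exact_mod_cast card_le_card (filter_subset _ _)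
      _ = D := by simp
  have hPrsum : ∑ p ∈ Pr, (p : ℝ)⁻¹ ≤ 1 + Real.log D :=
    (sum_le_sum_of_subset_of_nonneg (filter_subset _ _) fun m _ _ => by positivity).trans
      (Literature.NumberTheory.Sieve.Lichtman2020.sum_Icc_inv_le_one_add_log D)
  have hlogD0 : 0 ≤ Real.log D := Real.log_natCast_nonneg D
  calc (#((Icc 1 x).filter fun n : ℕ =>
          ∃ p : ℕ, p.Prime ∧ p ≤ D ∧ p ^ (Nat.log p D + 1) ∣ (g.eval (n : ℤ)).natAbs) : ℝ)
      ≤ #(Pr.biUnion fun p => (Icc 1 x).filter fun n : ℕ => (q p : ℤ) ∣ g.eval (n : ℤ)) := by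
        exact_mod_cast card_le_card hcover
    _ ≤ ∑ p ∈ Pr, (#((Icc 1 x).filter fun n : ℕ => (q p : ℤ) ∣ g.eval (n : ℤ)) : ℝ) := by
        exact_mod_cast card_biUnion_le
    _ ≤ ∑ p ∈ Pr, ((g.natDegree * M : ℕ) : ℝ) * ((x : ℝ) / q p + 1) := sum_le_sum hpiece
    _ ≤ ∑ p ∈ Pr, ((g.natDegree * M : ℕ) : ℝ) * ((x : ℝ) / Real.sqrt ((D : ℝ) + 1) * (p : ℝ)⁻¹ + 1) := by
        refine sum_le_sum fun p hp => ?_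
        have hp' : p.Prime := (mem_filter.mp hp).2
        have hp0 : (0 : ℝ) < p := by exact_mod_cast hp'.pos
        refine mul_le_mul_of_nonneg_left (add_le_add ?_ le_rfl) (by positivity)
        calc (x : ℝ) / q p ≤ x / ((p : ℝ) * Real.sqrt ((D : ℝ) + 1)) :=
              div_le_div_of_nonneg_left (Nat.cast_nonneg x) (by positivity) (hqlarge p hp)
          _ = (x : ℝ) / Real.sqrt ((D : ℝ) + 1) * (p : ℝ)⁻¹ := by
              field_simp
    _ = ((g.natDegree * M : ℕ) : ℝ) * ((x : ℝ) / Real.sqrt ((D : ℝ) + 1) * ∑ p ∈ Pr, (p : ℝ)⁻¹ + #Pr) := by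
        rw [← mul_sum, sum_add_distrib, mul_sum, sum_const, nsmul_eq_mul, mul_one]
    _ ≤ ((g.natDegree * M : ℕ) : ℝ) * ((x : ℝ) / Real.sqrt ((D : ℝ) + 1) * (1 + Real.log D) + D) := by
        gcongr
    _ = ((g.natDegree * M : ℕ) : ℝ) * ((x : ℝ) * (1 + Real.log D) / Real.sqrt ((D : ℝ) + 1) + D) := by
        ring

end LocatedMangoldt

end Summit.Parity.BatemanHorn.Theorems
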